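import Summits.NavierStokesRegularity.FluidComputer.ForcedContinuationHalfOpen
import Summits.NavierStokesRegularity.FluidComputer.DesignedBlowupRegularity
import Summits.NavierStokesRegularity.FluidComputer.DesignedBlowupEnergyClass
import Literature.Analysis.FluidPDE.NSForcedH1Continuation
import HarnessLib

/-!
# The forced `H¹` alternative modulo Tao's forced local theory: bounded enstrophy on `[0, τ)`
# extends a classical Clay-class solution past `τ`; every designed blow-up has unbounded enstrophy

Cell `ns-blowup`, seat `ns-blowup-ecbridge-2` (g4; the E–C endpoint theory seat). LABEL: E–C typing
(KERNEL modulo ONE named fact, F2 = `tao2011_smooth_local_existence_forced`, Tao 2013 Thm. 5.4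
(ii)+(iv) WITH forcing — the cell's single discharge engine). WHAT THIS IS NOT: not Navier–Stokes
evidence — continuation theorems for GIVEN classical solutions and a necessary condition on the TYPE
`DesignedBlowup`; nothing is constructed. Companion memo:
`run/shared/lean/pub/ns-blowup/ecbridge2/ECBRIDGE-2-MEMO-3.md` §2 (trust base).

## Content

ecbridge-1 g5's restart loop (`ForcedContinuationHalfOpen.exists_forced_extension_of_bounded_Ico`,
p434537) continues a classical forced solution past a half-open slab `[0, τ)` when the VELOCITY is
bounded there. Here the hypothesis is BOUNDED ENSTROPHY instead (plus Tao's spatial class on closed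
sub-slabs, which is FACT-FREE for finite-energy solutions with Clay data, lit g10 p429976): the `H¹`
radius `A² = sup energy + sup enstrophy` is uniform on `[0, τ)`, so ONE restart of F2 at `t₀ = τ − h/2`
(lifespan `h = h(A, force, ν)`) reaches `τ + h/2`; the piece is identified with the flow on every
closed sub-slab `[t₀, τ₁]`, `τ₁ < τ` (where the flow IS bounded, by Sobolev) through ecbridge-1's
W14-free `piece_eq_shift`, and glued (`IsClassicalNSSolutionOn.glue_Icc`, pressure matching
`exists_pressure_eq_on_Icc`) — verbatim ecbridge-1's gluing.

* `ForcedContinuation.exists_piece_of_enstrophy_bounded` — the single restarted piece;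
* **`ForcedContinuation.exists_forced_extension_of_enstrophy_bounded_Ico`** and
  **`ForcedContinuation.hasSmoothExtensionPast_of_enstrophy_bounded`** — GIVEN F2: classical on
  `[0, τ)` with uniform energy and ENSTROPHY bounds, Tao's spatial class on closed sub-slabs, Clay
  force ⇒ classical extension past `τ`;
* (the printed forced `H¹` alternative `lemarieRieusset2016_H1_continuation_forced` — LR16 Thm. 7.2,
  the seat's g0 named fact, hypothesis `hC` of `DesignedBlowupSerrinDivergence.lean` — was reduced to
  F2 independently and simultaneously in the Literature tree:
  `lemarieRieusset2016_H1_continuation_forced_of_smooth_local_existence`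
  (`NSForcedH1ContinuationOfLocalExistence.lean`, 10:22Z); the present statements differ in dropping
  the `∂ₜu`-class hypothesis of the fact and in taking the uniform energy on `[0, τ)` as input, which
  is what the type `DesignedBlowup` supplies fact-free);
* **`DesignedBlowup.enstrophy_unbounded_of_F2`** — every designed forced blow-up (`ν > 0`) has
  UNBOUNDED ENSTROPHY on `[0, T)`, modulo F2 ALONE (no LR16 fact, no `∂ₜu`/pressure hypotheses):
  Tao's spatial class is fact-free (`DesignedBlowup.hasBoundedSobolevNormsOn`, p432448), the energy is
  uniform (`DesignedBlowup.energy_le`, p431638), and maximality is the structure's `no_extension`.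

References: T. Tao, Anal. PDE 6 (2013) = arXiv:1108.1165, Thm. 5.4 (ii)+(iv), Lemma 8.1
[cite: Tao2011, Thm. 5.4]; P. G. Lemarié-Rieusset, *The Navier–Stokes Problem in the 21st Century*
(2016), Thm. 7.2, Thm. 11.2 [cite: LemarieRieusset2016, Thm. 7.2]; H. Sohr, *The Navier–Stokes
equations* (2001), Thm. V.1.5.1 [cite: Sohr2001, Thm. V.1.5.1]; J. T. Beale, T. Kato, A. Majda,
Comm. Math. Phys. 94 (1984) §1 [cite: BealeKatoMajda1984, §1].
-/

noncomputable section

open MeasureTheory Set Function Filter Topology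
open scoped ENNReal NNReal ContDiff

namespace Summit.NavierStokesRegularity.FluidComputer.PalasekTowerClayBridge

open Literature.Analysis.FluidPDE

namespace ForcedContinuation

/-- The energy of a field is the `L²` norm of its `0`-th derivative (private copy of a tree lemma).
[folklore] -/
private theorem lintegral_enorm_sq_eq_iteratedFDeriv_zero''
    (v : EuclideanSpace ℝ (Fin 3) → EuclideanSpace ℝ (Fin 3)) :
    ∫⁻ x, ‖v x‖ₑ ^ 2 = ∫⁻ x, ‖iteratedFDeriv ℝ 0 v x‖ₑ ^ 2 :=
  lintegral_congr fun x => by rw [← ofReal_norm, ← ofReal_norm, norm_iteratedFDeriv_zero]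

section Enstrophy

variable {ν τ : ℝ} {f u : ℝ → EuclideanSpace ℝ (Fin 3) → EuclideanSpace ℝ (Fin 3)}
  {p : ℝ → EuclideanSpace ℝ (Fin 3) → ℝ}

/-- **Tao's spatial class on closed sub-slabs gives a sup bound on each of them** (Sobolev
`H² ⊂ C_B`, tree theorem `linfty_bound_of_hasBoundedSobolevNormsOn_holds`). [folklore] -/
theorem exists_bound_Icc_of_taoClass (hu : IsClassicalNSSolutionOn (Ico 0 τ) ν f u p)
    (hTao : ∀ τ₁ ∈ Ioo 0 τ, HasBoundedSobolevNormsOn (Icc 0 τ₁) u) {τ₁ : ℝ} (h₁ : 0 < τ₁)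
    (h₂ : τ₁ < τ) : ∃ M : ℝ, ∀ t ∈ Icc 0 τ₁, ∀ x, ‖u t x‖ ≤ M :=
  linfty_bound_of_hasBoundedSobolevNormsOn_holds
    (fun _ ht => contDiff_infty.1 (hu.contDiff_velocity ⟨ht.1, lt_of_le_of_lt ht.2 h₂⟩) 2)
    (hTao τ₁ ⟨h₁, h₂⟩)

/-- **ONE restarted piece reaching past `τ`, from a UNIFORM ENSTROPHY BOUND** (GIVEN F2). For a
classical forced solution on `[0, τ)` (`ν > 0`, Clay force) with energy `≤ E₀ < ⊤` and enstrophy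
`≤ K < ⊤` on `[0, τ)` and Tao's spatial class on closed sub-slabs: with the `H¹` radius
`A² = E₀ + K` and the lifespan `h = h(A, force, ν) ≤ τ` of Tao's Thm. 5.4 (ii), the slice `u(τ − h/2)`
is an admissible `H^∞` datum, and F2 gives a Tao-class classical piece `(w, q)` on `[0, h]` under the
shifted force with `w(0) = u(τ − h/2)`. [cite: Tao2011, Thm. 5.4 (ii)+(iv)] -/
theorem exists_piece_of_enstrophy_bounded (hF : tao2011_smooth_local_existence_forced)
    (hν : 0 < ν) (hτ : 0 < τ) (hs : IsSmoothOnHalfSpace f) (hd : HasRapidSpaceTimeDecay f)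
    (hu : IsClassicalNSSolutionOn (Ico 0 τ) ν f u p)
    (hE : ∃ C : ℝ≥0∞, C < ⊤ ∧ ∀ t ∈ Ico 0 τ, ∫⁻ x, ‖u t x‖ₑ ^ 2 ≤ C)
    (hK : ∃ K : ℝ≥0∞, K < ⊤ ∧ ∀ t ∈ Ico 0 τ,
      ∫⁻ x, ENNReal.ofReal (frobeniusNormSq (fderiv ℝ (u t) x)) ≤ K)
    (hTao : ∀ τ₁ ∈ Ioo 0 τ, HasBoundedSobolevNormsOn (Icc 0 τ₁) u) :
    ∃ (h tN : ℝ) (w : ℝ → EuclideanSpace ℝ (Fin 3) → EuclideanSpace ℝ (Fin 3))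
      (q : ℝ → EuclideanSpace ℝ (Fin 3) → ℝ),
      0 < h ∧ 0 ≤ tN ∧ tN + h / 2 ≤ τ ∧ τ < tN + h ∧
      IsClassicalNSSolutionOn (Icc 0 h) ν (fun s => f (s + tN)) w q ∧ w 0 = u tN ∧
      HasBoundedSobolevNormsOn (Icc 0 h) w ∧
      (∃ C : ℝ≥0∞, C < ⊤ ∧ ∀ t ∈ Icc 0 h, ∫⁻ x, ‖w t x‖ₑ ^ 2 ≤ C) := by
  obtain ⟨c, hc, hloc⟩ := hF
  obtain ⟨C₀, C₁, B, hB0, hC₀, hC₁, hBf⟩ := exists_force_slice_bounds hs hd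
  obtain ⟨E₀, hE₀, hEb⟩ := hE
  obtain ⟨K, hKt, hKb⟩ := hK
  -- the uniform `H¹` radius `A` and the lifespan `h`
  set A : ℝ := Real.sqrt (E₀ + K).toReal with hA
  have hA0 : 0 ≤ A := Real.sqrt_nonneg _
  have hA2 : ENNReal.ofReal (A ^ 2) = E₀ + K := by
    rw [hA, Real.sq_sqrt ENNReal.toReal_nonneg, ENNReal.ofReal_toReal]
    exact (ENNReal.add_lt_top.2 ⟨hE₀, hKt⟩).ne
  set h : ℝ := min τ (min 1 (c * ν ^ 3 / (A + B + 1) ^ 4)) with hh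
  have hhτ : h ≤ τ := min_le_left _ _
  have hh1 : h ≤ 1 := (min_le_right _ _).trans (min_le_left _ _)
  have hhc : h ≤ c * ν ^ 3 / (A + B + 1) ^ 4 := (min_le_right _ _).trans (min_le_right _ _)
  have hhpos : 0 < h := lt_min hτ (lt_min one_pos (by positivity))
  have hsmall : (A + B * h) ^ 4 * h ≤ c * ν ^ 3 := by
    have h1 : A + B * h ≤ A + B + 1 := by nlinarith
    have h2 : 0 ≤ A + B * h := by positivity
    calc (A + B * h) ^ 4 * h ≤ (A + B + 1) ^ 4 * h :=
          mul_le_mul_of_nonneg_right (pow_le_pow_left₀ h2 h1 4) hhpos.le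
      _ ≤ (A + B + 1) ^ 4 * (c * ν ^ 3 / (A + B + 1) ^ 4) :=
          mul_le_mul_of_nonneg_left hhc (by positivity)
      _ = c * ν ^ 3 := by field_simp
  -- the restart time `tN = τ − h/2`
  set tN : ℝ := τ - h / 2 with htN
  have htN0 : 0 ≤ tN := by rw [htN]; linarith
  have htNτ : tN < τ := by rw [htN]; linarith
  -- the slice `u tN` is `H^∞` (Tao class on `[0, (tN + τ)/2]`) with enstrophy `≤ K`
  have hmid : tN < (tN + τ) / 2 ∧ (tN + τ) / 2 < τ := ⟨by linarith, by linarith⟩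
  have hHinf : ∀ m : ℕ, ∫⁻ x, ‖iteratedFDeriv ℝ m (u tN) x‖ₑ ^ 2 < ⊤ := fun m => by
    obtain ⟨C, hC⟩ := hTao _ ⟨htN0.trans_lt hmid.1, hmid.2⟩ m
    exact (hC tN ⟨htN0, hmid.1.le⟩).trans_lt ENNReal.coe_lt_top
  have hdat : (∫⁻ x, ‖u tN x‖ₑ ^ 2) +
      (∫⁻ x, ENNReal.ofReal (frobeniusNormSq (fderiv ℝ (u tN) x))) ≤ ENNReal.ofReal (A ^ 2) := by
    rw [hA2]; exact add_le_add (hEb tN ⟨htN0, htNτ⟩) (hKb tN ⟨htN0, htNτ⟩)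
  have hfB : ∀ t ∈ Icc 0 h, (∫⁻ x, ‖(fun s => f (s + tN)) t x‖ₑ ^ 2) +
      (∫⁻ x, ENNReal.ofReal (frobeniusNormSq (fderiv ℝ ((fun s => f (s + tN)) t) x))) ≤
        ENNReal.ofReal (B ^ 2) := fun t ht => hBf (t + tN) (by linarith [ht.1])
  obtain ⟨w, q, hw, hw0, hwS, -, -, -⟩ := hloc hν hhpos (hu.contDiff_velocity ⟨htN0, htNτ⟩)
    (hu.divFree tN ⟨htN0, htNτ⟩) hHinf (hs.isSmoothSpaceTimeOn_Icc_timeShift htN0 h)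
    (hd.hasUniformRapidDecayOn_Icc_timeShift hs htN0 hhpos) hA0 hB0 hdat hfB hsmall
  have hEw : ∃ C : ℝ≥0∞, C < ⊤ ∧ ∀ t ∈ Icc 0 h, ∫⁻ x, ‖w t x‖ₑ ^ 2 ≤ C := by
    obtain ⟨C, hC⟩ := hwS 0
    exact ⟨C, ENNReal.coe_lt_top, fun t ht => by
      rw [lintegral_enorm_sq_eq_iteratedFDeriv_zero'']; exact hC t ht⟩
  exact ⟨h, tN, w, q, hhpos, htN0, by rw [htN]; linarith, by rw [htN]; linarith, hw, hw0, hwS, hEw⟩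

/-- **Extension past a half-open slab from a UNIFORM ENSTROPHY BOUND (forced, GIVEN F2).** A
classical solution of the forced system (`ν > 0`, Clay force) on `[0, τ) × ℝ³` with energy and
ENSTROPHY bounded uniformly on `[0, τ)` and Tao's spatial class on every closed sub-slab has a
classical finite-energy extension `(U, P)` to a CLOSED slab `[0, T']`, `T' > τ`, with `U = u` on
`[0, τ)`. Proof: the piece of `exists_piece_of_enstrophy_bounded`, identified with the flow on every
closed sub-slab `[t_N, τ₁]`, `τ₁ < τ` (the flow is bounded there by Sobolev, so ecbridge-1's W14-free
`piece_eq_shift` applies), glued along `(t_N, t_N + h/4)` with pressure matching — ecbridge-1 g5's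
gluing, verbatim. [cite: Tao2011, Thm. 5.4 (ii)+(iv)] [cite: Sohr2001, Thm. V.1.5.1] -/
theorem exists_forced_extension_of_enstrophy_bounded_Ico (hF : tao2011_smooth_local_existence_forced)
    (hν : 0 < ν) (hτ : 0 < τ) (hs : IsSmoothOnHalfSpace f) (hd : HasRapidSpaceTimeDecay f)
    (hu : IsClassicalNSSolutionOn (Ico 0 τ) ν f u p)
    (hE : ∃ C : ℝ≥0∞, C < ⊤ ∧ ∀ t ∈ Ico 0 τ, ∫⁻ x, ‖u t x‖ₑ ^ 2 ≤ C)
    (hK : ∃ K : ℝ≥0∞, K < ⊤ ∧ ∀ t ∈ Ico 0 τ,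
      ∫⁻ x, ENNReal.ofReal (frobeniusNormSq (fderiv ℝ (u t) x)) ≤ K)
    (hTao : ∀ τ₁ ∈ Ioo 0 τ, HasBoundedSobolevNormsOn (Icc 0 τ₁) u) :
    ∃ T' : ℝ, τ < T' ∧
      ∃ (U : ℝ → EuclideanSpace ℝ (Fin 3) → EuclideanSpace ℝ (Fin 3))
        (P : ℝ → EuclideanSpace ℝ (Fin 3) → ℝ),
        IsClassicalNSSolutionOn (Icc 0 T') ν f U P ∧
        (∀ t ∈ Ico 0 τ, U t = u t) ∧
        (∃ C : ℝ≥0∞, C < ⊤ ∧ ∀ t ∈ Icc 0 T', ∫⁻ x, ‖U t x‖ₑ ^ 2 ≤ C) := by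
  obtain ⟨E₀, hE₀, hEb⟩ := hE
  obtain ⟨h, tN, w, q, hhpos, htN0, hNle, hNspec, hw, hw0, hwS, hEw⟩ :=
    exists_piece_of_enstrophy_bounded hF hν hτ hs hd hu ⟨E₀, hE₀, hEb⟩ hK hTao
  have huc : ∀ τ₁, 0 < τ₁ → τ₁ < τ → IsClassicalNSSolutionOn (Icc 0 τ₁) ν f u p := fun τ₁ h₁ h₂ =>
    hu.mono (fun t ht => ⟨ht.1, lt_of_le_of_lt ht.2 h₂⟩) (uniqueDiffOn_Icc h₁)
  have hEc : ∀ τ₁, τ₁ < τ → ∃ C : ℝ≥0∞, C < ⊤ ∧ ∀ t ∈ Icc 0 τ₁, ∫⁻ x, ‖u t x‖ₑ ^ 2 ≤ C :=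
    fun τ₁ h₂ => ⟨E₀, hE₀, fun t ht => hEb t ⟨ht.1, lt_of_le_of_lt ht.2 h₂⟩⟩
  have hMc : ∀ τ₁, 0 < τ₁ → τ₁ < τ → ∃ M : ℝ, ∀ t ∈ Icc 0 τ₁, ∀ x, ‖u t x‖ ≤ M :=
    fun τ₁ h₁ h₂ => exists_bound_Icc_of_taoClass hu hTao h₁ h₂
  have htNτ : tN < τ := by linarith
  -- identification with the flow on the closed sub-slab `[tN, tN + h/4] ⊂ [0, τ)`, pressure matching
  have h14 : tN + h / 4 < τ := by linarith
  obtain ⟨M14, hM14⟩ := hMc _ (by linarith) h14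
  have heq : ∀ s ∈ Icc 0 (h / 4), w s = u (s + tN) :=
    piece_eq_shift hν hs hd (huc _ (by linarith) h14) (hEc _ h14) hM14 htN0 (by linarith)
      le_rfl (by linarith) hw hEw hw0
  obtain ⟨q', hw', hq'⟩ := IsClassicalNSSolutionOn.exists_pressure_eq_on_Icc
    (shift_classical (huc _ (by linarith) h14) htN0 (by linarith : 0 < h / 4) le_rfl) hw
    (by linarith : 0 < h / 4) (by linarith) heq
  -- shift the piece back to `[tN, tN + h]`
  set W : ℝ → EuclideanSpace ℝ (Fin 3) → EuclideanSpace ℝ (Fin 3) := fun t => w (t + -tN) with hW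
  set Q : ℝ → EuclideanSpace ℝ (Fin 3) → ℝ := fun t => q' (t + -tN) with hQ
  have hWsol : IsClassicalNSSolutionOn (Icc tN (tN + h)) ν f W Q := by
    have h1 := (hw'.comp_add_right (-tN)).mono (S' := Icc tN (tN + h))
      (fun t ht => ⟨by linarith [ht.1], by linarith [ht.2]⟩) (uniqueDiffOn_Icc (by linarith))
    refine ⟨h1.smooth_velocity, h1.smooth_pressure, fun t ht x => ?_, h1.divFree⟩
    have h2 := h1.momentum t ht x
    simp only [neg_add_cancel_right] at h2
    exact h2
  -- agreement with `(u, p)` on `[tN, tN + h/4]`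
  have hagree : ∀ t ∈ Icc tN (tN + h / 4), u t = W t ∧ p t = Q t := by
    intro t ht
    have hmem : t + -tN ∈ Icc 0 (h / 4) := ⟨by linarith [ht.1], by linarith [ht.2]⟩
    refine ⟨?_, ?_⟩
    · show u t = w (t + -tN)
      rw [heq _ hmem, neg_add_cancel_right]
    · show p t = q' (t + -tN)
      rw [hq' _ hmem, neg_add_cancel_right]
  -- velocity agreement on the whole of `[tN, τ)` (pointwise restart of the uniqueness)
  have hagreeU : ∀ t, tN < t → t < τ → W t = u t := by
    intro t ht1 ht2
    have hτ' : 0 < t + -tN := by linarith only [ht1]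
    have hle : tN + (t + -tN) ≤ t := le_of_eq (by ring)
    have hh' : t + -tN ≤ h := by linarith only [ht2, hNspec]
    have ht0 : 0 < t := lt_of_le_of_lt htN0 ht1
    obtain ⟨Mt, hMt⟩ := hMc t ht0 ht2
    have key : ∀ s ∈ Icc 0 (t + -tN), w s = u (s + tN) :=
      piece_eq_shift (τ := t) (t₀ := tN) (τ' := t + -tN) (T := h) hν hs hd (huc t ht0 ht2)
        (hEc t ht2) hMt htN0 hτ' hle hh' hw hEw hw0
    have key' := key (t + -tN) ⟨hτ'.le, le_rfl⟩
    show w (t + -tN) = u t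
    rw [key', neg_add_cancel_right]
  -- glue along `(tN, tN + h/4)`
  set m : ℝ := tN + h / 8 with hm
  have hglue := IsClassicalNSSolutionOn.glue_Icc (huc _ (by linarith) h14) hWsol htN0
    (by linarith : tN < m) (by linarith : m < tN + h / 4) (by linarith : tN + h / 4 ≤ tN + h)
    (fun t ht => hagree t ⟨ht.1.le, ht.2.le⟩)
  obtain ⟨Cw, hCwt, hCw⟩ := hEw
  refine ⟨tN + h, by linarith, _, _, hglue, fun t ht => ?_, ⟨max E₀ Cw, max_lt hE₀ hCwt, fun t ht => ?_⟩⟩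
  · by_cases htm : t ≤ m
    · exact if_pos htm
    · simp only [if_neg htm]
      exact hagreeU t (by linarith) ht.2
  · by_cases htm : t ≤ m
    · simp only [if_pos htm]
      exact (hEb t ⟨ht.1, by linarith⟩).trans (le_max_left _ _)
    · simp only [if_neg htm]
      show ∫⁻ x, ‖w (t + -tN) x‖ₑ ^ 2 ≤ max E₀ Cw
      exact (hCw (t + -tN) ⟨by linarith, by linarith [ht.2]⟩).trans (le_max_right _ _)

/-- **`HasSmoothExtensionPast` from bounded enstrophy**, GIVEN F2 (packaging).
[cite: Tao2011, Thm. 5.4 (ii)+(iv)] [cite: LemarieRieusset2016, Thm. 7.2] -/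
theorem hasSmoothExtensionPast_of_enstrophy_bounded (hF : tao2011_smooth_local_existence_forced)
    (hν : 0 < ν) (hτ : 0 < τ) (hs : IsSmoothOnHalfSpace f) (hd : HasRapidSpaceTimeDecay f)
    (hu : IsClassicalNSSolutionOn (Ico 0 τ) ν f u p)
    (hE : ∃ C : ℝ≥0∞, C < ⊤ ∧ ∀ t ∈ Ico 0 τ, ∫⁻ x, ‖u t x‖ₑ ^ 2 ≤ C)
    (hK : ∃ K : ℝ≥0∞, K < ⊤ ∧ ∀ t ∈ Ico 0 τ,
      ∫⁻ x, ENNReal.ofReal (frobeniusNormSq (fderiv ℝ (u t) x)) ≤ K)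
    (hTao : ∀ τ₁ ∈ Ioo 0 τ, HasBoundedSobolevNormsOn (Icc 0 τ₁) u) :
    HasSmoothExtensionPast ν f u τ := by
  obtain ⟨T', hT', U, P, hUP, hagree, -⟩ :=
    exists_forced_extension_of_enstrophy_bounded_Ico hF hν hτ hs hd hu hE hK hTao
  exact ⟨T', hT', U, P, hUP.mono Ico_subset_Icc_self (uniqueDiffOn_Ico 0 T'), hagree⟩

end Enstrophy

end ForcedContinuation

end Summit.NavierStokesRegularity.FluidComputer.PalasekTowerClayBridge

/-! ## Every designed forced blow-up has unbounded enstrophy, modulo F2 alone -/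

namespace Summit.NavierStokesRegularity.FluidComputer.DesignedBlowup

open Literature.Analysis.FluidPDE
open Summit.NavierStokesRegularity.FluidComputer.PalasekTowerClayBridge

variable {ν : ℝ} (D : DesignedBlowup ν)

/-- **The enstrophy of a designed forced blow-up is NOT bounded on `[0, T)`, GIVEN F2 only** (`ν > 0`):
uniform energy (`energy_le`, fact-free), Tao's spatial class on closed sub-slabs
(`hasBoundedSobolevNormsOn`, fact-free), Clay datum and force, and maximality (`no_extension`) feed
`ForcedContinuation.hasSmoothExtensionPast_of_enstrophy_bounded`. No LR16 fact, no hypothesis on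
`∂ₜu` or on any pressure. [cite: Tao2011, Thm. 5.4 (ii)+(iv)] [cite: LemarieRieusset2016, Thm. 7.2] -/
theorem not_enstrophy_bounded_of_F2 (hF : tao2011_smooth_local_existence_forced) (hν : 0 < ν) :
    ¬ ∃ B : ℝ≥0, ∀ t ∈ Set.Ico 0 D.T,
        ∫⁻ x, ENNReal.ofReal (frobeniusNormSq (fderiv ℝ (D.u t) x)) ≤ B := by
  rintro ⟨B, hB⟩
  exact D.no_extension (ForcedContinuation.hasSmoothExtensionPast_of_enstrophy_bounded hF hν D.T_pos
    D.force_smooth D.force_decay D.classical (D.energy_le hν) ⟨B, ENNReal.coe_lt_top, hB⟩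
    (D.hasBoundedSobolevNormsOn_subslabs hν))

/-- **Unbounded enstrophy at the blow-up time, modulo F2 alone**: for every `B` some slice `t < T`
has `∫|∇u(t)|² > B`. [cite: LemarieRieusset2016, Thm. 7.2] [cite: Tao2011, Thm. 5.4 (ii)+(iv)] -/
theorem enstrophy_unbounded_of_F2 (hF : tao2011_smooth_local_existence_forced) (hν : 0 < ν) :
    ∀ B : ℝ≥0, ∃ t ∈ Set.Ico 0 D.T,
      (B : ℝ≥0∞) < ∫⁻ x, ENNReal.ofReal (frobeniusNormSq (fderiv ℝ (D.u t) x)) := by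
  intro B
  by_contra h
  refine D.not_enstrophy_bounded_of_F2 hF hν ⟨B, fun t ht => ?_⟩
  exact not_lt.1 fun hlt => h ⟨t, ht, hlt⟩

end Summit.NavierStokesRegularity.FluidComputer.DesignedBlowup

end
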